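import Summits.BirchSwinnertonDyer.BirchSwinnertonDyer.Theorems.CyclotomicUntwistSigmaLineFamilyHeightDatumUnique
import Literature.NumberTheory.EllipticCurves.PSLineHeight
import HarnessLib

/-!
# Route `CyclotomicUntwist`, crux K1 `PSRankOneLowerHalfAtThree` (stmt-BirchSwinnertonDyer-21580):
# the σ-LINE FAMILY — UNIQUENESS OF D2 DATA: a `PSLineHeightData` (any `ℚ₃`-algebra of coefficients) is
# determined by its line self-pairings on the deep admissible locus; so the σ-line data of given constants
# (the D5 candidate `IsSigmaLineHeightAt`) are UNIQUE — the `isCanonicalFor_unique` the pen asked for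

Cell `pub/bsd-wall` (D-0145 line `route-BirchSwinnertonDyer-CyclotomicUntwist`), seat `bsd-line-cycu-p1`
g4 (K1 base). THEOREMS ONLY (no definition, no named fact, no `sorry`); helper `--supports` K1 =
stmt-BirchSwinnertonDyer-21580. Sequel of `…SigmaLineFamilyHeightDatumUnique.lean` (deep admissible
multiples, `ℚ_p`-valued uniqueness). BSD is not proved by this file and nothing here is evidence for or
against K1/K2.

* `pairing_eq_of_sq_eq_on_alg` — the tree's polarisation/uniqueness lemma `pairing_eq_of_sq_eq_on` with
  values in any commutative `ℚ₃`-algebra `R` (non-zero naturals are units of `R`).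
* **`psLineHeightData_ext_of_deep`** — for `W/ℚ` globally minimal: two `PSLineHeightData W R` whose
  self-pairings agree on every LINE at every deep admissible rational point are EQUAL (off the lines both
  vanish by the D2 axiom; on the lines: deep admissible multiples `exists_deep_admissible_nsmul` + polarisation).
* **`psLineHeightData_unique_of_spec`** — hence two data satisfying the σ-line spec with the same
  `(c₀, a, b)` (`h_χ(P,P) = ι h_{σ_{c₀}}(P) + (ι a + ι b χ(2) − ι c₀)·ι(log_W z P)²` on the deep locus; the D5
  candidate `Cruxes/PSRankOneLowerHalfAtThree/Lines/D5_sigma_line_candidate.lean`) coincide: with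
  `exists_psLineHeightData` this is `∃!` — the canonicity predicate PINS the datum (cycu-p4's rank-one
  rigidity `CyclotomicUntwistLineHeightRigidity` made rank-free and constructive).

References: Mazur–Stein–Tate 2006 §1 ("extends uniquely"); Benois 2020 §0.3; Schneider 1982 §1.
[cite: MazurSteinTate2006, §2.7] [cite: Benois2020, §0.3] [cite: Schneider1982PadicHeightI, §1]
-/

set_option autoImplicit false
-- single-conjunct summit: `Summit.BirchSwinnertonDyer.BirchSwinnertonDyer.…` repeats the name by design
set_option linter.dupNamespace false

noncomputable section

open scoped Classical

open WeierstrassCurve Literature.NumberTheory.EllipticCurves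
  Summit.BirchSwinnertonDyer.Rank1Residual.Additive
  Summit.BirchSwinnertonDyer.BirchSwinnertonDyer.Theorems.PSSigmaLineFamilyHeightDatumUnique

namespace Summit.BirchSwinnertonDyer.BirchSwinnertonDyer.Theorems.PSSigmaLineFamilyLineDataUnique

/-! ### §1 Polarisation with values in a `ℚ₃`-algebra -/

section Alg

variable {A : Type*} [AddCommGroup A] {R : Type*} [CommRing R] [Algebra ℚ_[3] R]

/-- Non-zero naturals are units in a `ℚ₃`-algebra. [folklore] -/
theorem isUnit_natCast {m : ℕ} (hm : m ≠ 0) : IsUnit ((m : R)) := by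
  have h : IsUnit ((m : ℚ_[3])) := (Nat.cast_ne_zero.mpr hm : (m : ℚ_[3]) ≠ 0).isUnit
  have := h.map (algebraMap ℚ_[3] R)
  rwa [map_natCast] at this

/-- **Polarisation / uniqueness with values in a `ℚ₃`-algebra**: two symmetric biadditive torsion-vanishing
pairings `A × A → R` whose quadratic forms agree on a set meeting a non-zero multiple of every non-torsion
element are equal. [Mazur–Stein–Tate 2006, §1] [folklore] -/
theorem pairing_eq_of_sq_eq_on_alg (B₁ B₂ : A →+ A →+ R)
    (symm₁ : ∀ P Q, B₁ P Q = B₁ Q P) (symm₂ : ∀ P Q, B₂ P Q = B₂ Q P)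
    (tors₁ : ∀ P Q, IsOfFinAddOrder P → B₁ P Q = 0) (tors₂ : ∀ P Q, IsOfFinAddOrder P → B₂ P Q = 0)
    (S : Set A) (hS : ∀ P, ¬ IsOfFinAddOrder P → ∃ m : ℕ, m ≠ 0 ∧ m • P ∈ S)
    (h : ∀ Q ∈ S, B₁ Q Q = B₂ Q Q) : B₁ = B₂ := by
  -- adapted from Literature/NumberTheory/EllipticCurves/CanonicalPAdicHeight.lean (`pairing_eq_of_sq_eq_on`)
  have hsq : ∀ P, B₁ P P = B₂ P P := by
    intro P
    by_cases hP : IsOfFinAddOrder P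
    · rw [tors₁ P P hP, tors₂ P P hP]
    · obtain ⟨m, hm, hmS⟩ := hS P hP
      have key := h _ hmS
      simp only [map_nsmul, AddMonoidHom.nsmul_apply, nsmul_eq_mul, ← mul_assoc] at key
      exact ((isUnit_natCast hm).mul (isUnit_natCast hm)).mul_left_cancel key
  ext P Q
  have h₁ : 2 * B₁ P Q = B₁ (P + Q) (P + Q) - B₁ P P - B₁ Q Q := by
    simp only [map_add, AddMonoidHom.add_apply, symm₁ Q P]; ring
  have h₂ : 2 * B₂ P Q = B₂ (P + Q) (P + Q) - B₂ P P - B₂ Q Q := by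
    simp only [map_add, AddMonoidHom.add_apply, symm₂ Q P]; ring
  have h2 : (2 : R) * B₁ P Q = 2 * B₂ P Q := by rw [h₁, h₂, hsq, hsq, hsq]
  have hu : IsUnit ((2 : R)) := by
    have := isUnit_natCast (R := R) (m := 2) two_ne_zero
    rwa [Nat.cast_ofNat] at this
  exact hu.mul_left_cancel h2

end Alg

/-! ### §2 Uniqueness of D2 data on the deep admissible locus -/

section D2

variable (W : WeierstrassCurve ℚ) [W.IsElliptic] [W.IsGloballyMinimal] {R : Type*} [CommRing R] [Algebra ℚ_[3] R]

/-- **A `PSLineHeightData` is determined by its line self-pairings on the deep admissible locus.**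
[Mazur–Stein–Tate 2006, §1; Benois 2020, §0.3] [cite: MazurSteinTate2006, §2.7] [cite: Benois2020, §0.3] -/
theorem psLineHeightData_ext_of_deep {Dh₁ Dh₂ : W.PSLineHeightData R}
    (h : ∀ (χ : DirichletCharacter R 9), χ ^ 3 = 1 → χ ≠ 1 →
      ∀ {x y : ℚ} (hxy : W.toAffine.Nonsingular x y),
        1 < ‖(x : ℚ_[3])‖ → ‖(-(x : ℚ_[3]) / (y : ℚ_[3]))‖ ≤ ((3 : ℝ)⁻¹) ^ 3 →
          (∀ ℓ : ℕ, ℓ.Prime → W.HasNonsingularReductionAt ℓ x y) →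
            Dh₁.pairing χ (.some x y hxy) (.some x y hxy) = Dh₂.pairing χ (.some x y hxy) (.some x y hxy)) :
    Dh₁ = Dh₂ := by
  haveI : Fact (Nat.Prime 3) := ⟨Nat.prime_three⟩
  have hpair : Dh₁.pairing = Dh₂.pairing := by
    funext χ
    by_cases hχ : χ ^ 3 = 1 ∧ χ ≠ 1
    · refine pairing_eq_of_sq_eq_on_alg _ _ (Dh₁.symm χ) (Dh₂.symm χ) (Dh₁.map_torsion χ) (Dh₂.map_torsion χ)
        {Q : W.toAffine.Point | ∃ (x y : ℚ) (hxy : W.toAffine.Nonsingular x y), Q = .some x y hxy ∧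
          1 < ‖(x : ℚ_[3])‖ ∧ ‖(-(x : ℚ_[3]) / (y : ℚ_[3]))‖ ≤ ((3 : ℝ)⁻¹) ^ 3 ∧
            ∀ ℓ : ℕ, ℓ.Prime → W.HasNonsingularReductionAt ℓ x y} ?_ ?_
      · intro P hP
        obtain ⟨m, hm, x, y, hxy, hmP, hx, hz, hns⟩ := exists_deep_admissible_nsmul W (p := 3) P hP
        exact ⟨m, hm, x, y, hxy, hmP, hx, hz, hns⟩
      · rintro Q ⟨x, y, hxy, rfl, hx, hz, hns⟩
        exact h χ hχ.1 hχ.2 hxy hx hz hns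
    · rw [Dh₁.eq_zero_of_not_isLine χ hχ, Dh₂.eq_zero_of_not_isLine χ hχ]
  cases Dh₁; cases Dh₂; cases hpair; rfl

/-- **The σ-line datum of given constants is UNIQUE** (the D5 candidate pins the datum): two
`PSLineHeightData W R` both satisfying the σ-line spec with the same reference `c₀` and coordinates
`(a, b)` of the line constants `c_χ = ι a + ι b·χ(2)` are equal. With `exists_psLineHeightData` this is
`∃!`. [Benois 2020, §0.3; Mazur–Stein–Tate 2006, §1] [cite: Benois2020, §0.3] [cite: MazurSteinTate2006, §2.7] -/
theorem psLineHeightData_unique_of_spec {c₀ a b : ℚ_[3]} {Dh₁ Dh₂ : W.PSLineHeightData R}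
    (h₁ : ∀ (χ : DirichletCharacter R 9), χ ^ 3 = 1 → χ ≠ 1 →
      ∀ {x y : ℚ} (hxy : W.toAffine.Nonsingular x y),
        1 < ‖(x : ℚ_[3])‖ → ‖(-(x : ℚ_[3]) / (y : ℚ_[3]))‖ ≤ ((3 : ℝ)⁻¹) ^ 3 →
          (∀ ℓ : ℕ, ℓ.Prime → W.HasNonsingularReductionAt ℓ x y) →
            Dh₁.pairing χ (.some x y hxy) (.some x y hxy) =
              algebraMap ℚ_[3] R (CensusX42.sigmaHeight W 3 ((W.baseChange ℚ_[3]).formalSigma c₀) (.some x y hxy)) +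
                (algebraMap ℚ_[3] R a + algebraMap ℚ_[3] R b * χ 2 - algebraMap ℚ_[3] R c₀) *
                  algebraMap ℚ_[3] R (padicEval (W.baseChange ℚ_[3]).formalLog (-(x : ℚ_[3]) / (y : ℚ_[3]))) ^ 2)
    (h₂ : ∀ (χ : DirichletCharacter R 9), χ ^ 3 = 1 → χ ≠ 1 →
      ∀ {x y : ℚ} (hxy : W.toAffine.Nonsingular x y),
        1 < ‖(x : ℚ_[3])‖ → ‖(-(x : ℚ_[3]) / (y : ℚ_[3]))‖ ≤ ((3 : ℝ)⁻¹) ^ 3 →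
          (∀ ℓ : ℕ, ℓ.Prime → W.HasNonsingularReductionAt ℓ x y) →
            Dh₂.pairing χ (.some x y hxy) (.some x y hxy) =
              algebraMap ℚ_[3] R (CensusX42.sigmaHeight W 3 ((W.baseChange ℚ_[3]).formalSigma c₀) (.some x y hxy)) +
                (algebraMap ℚ_[3] R a + algebraMap ℚ_[3] R b * χ 2 - algebraMap ℚ_[3] R c₀) *
                  algebraMap ℚ_[3] R (padicEval (W.baseChange ℚ_[3]).formalLog (-(x : ℚ_[3]) / (y : ℚ_[3]))) ^ 2) :
    Dh₁ = Dh₂ :=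
  psLineHeightData_ext_of_deep W fun χ h3 h1 x y hxy hx hz hns => by
    rw [h₁ χ h3 h1 hxy hx hz hns, h₂ χ h3 h1 hxy hx hz hns]

end D2

end Summit.BirchSwinnertonDyer.BirchSwinnertonDyer.Theorems.PSSigmaLineFamilyLineDataUnique

end
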